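import Literature.Analysis.FluidPDE.SereginSverakScaledEnergy
import Literature.Analysis.FluidPDE.PressureDecayEstimate
import HarnessLib

/-!
# Seregin–Šverák 2009, (as13) on their coordinate cylinders `𝒞`, from the ball form of the
pressure decay estimate

Analysis/FluidPDE proof file (no new definitions, no new named facts). The tree carries two
renderings of the display (as13) of G. Seregin, V. Šverák, Comm. PDE 34 (2009) = arXiv:0804.1803,
proof of Lemma 3.5, p. 10 — "the decay estimate for the pressure field
`D(z_b, ϱ; q) ≤ c [ (ϱ/r) D(z_b, r; q) + (r/ϱ)² C(z_b, r; v) ]`, `0 < ϱ ≤ r`":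

* `SereginSverak2009.PressureDecay` (`SereginSverakScaledEnergy.lean`), verbatim in the setting of
  the proof of Lemma 3.5: centres `z_b = (0, b e₃)`, `|b| ≤ 1/4`, radii `0 < ϱ ≤ r < 1/4`, the
  quantities `pressureD`, `cubicC` over Seregin–Šverák's cylinders
  `Q(z₀, R) = 𝒞(x₀, R) × ]t₀ - R², t₀[`, `𝒞(x₀, R) = {|x' - x₀'| < R, |x₃ - x₀₃| < R}`, for the
  solutions `IsAxisymmetricLocalSolution u p` of Thm. 3.1 (Navier–Stokes in `𝒟'(Q)`,
  `u ∈ L³(Q)`, `p ∈ L^{3/2}(Q)`, axisymmetric) under the Type I bound;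
* `seregin_sverak_pressure_decay` (`PressureDecayEstimate.lean`), the same estimate for every
  distributional solution on an open set, over the Caffarelli–Kohn–Nirenberg cylinders with
  **balls** as space sections (`cknD`, `cknC`).

This file **proves the first from the second**
(`SereginSverak2009.pressureDecay_of_seregin_sverak_pressure_decay`), as announced in the module
docstring of `PressureDecayEstimate.lean`: since `B(x₀, R) ⊆ 𝒞(x₀, R) ⊆ B(x₀, √2 R)`
(`ball_subset_spaceCyl`, `spaceCyl_subset_ball`) and the time windows agree,
`D_𝒞(ϱ) ≤ 2 D_B(√2 ϱ)`, `D_B(r) ≤ D_𝒞(r)`, `C_B(r) ≤ C_𝒞(r)`; for `√2 ϱ ≤ r` the ball estimate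
between the radii `√2 ϱ ≤ r` gives `D_𝒞(ϱ) ≤ 2c (√2 (ϱ/r) D_𝒞(r) + ½ (r/ϱ)² C_𝒞(r))`, and for
`r < √2 ϱ` trivially `D_𝒞(ϱ) ≤ (r/ϱ)² D_𝒞(r) ≤ 2 D_𝒞(r) ≤ 3 (ϱ/r) D_𝒞(r)`; both are
`≤ (3c + 3) [(ϱ/r) D_𝒞(r) + (r/ϱ)² C_𝒞(r)]`. The ball cylinders `Q_r(0, b e₃)`, `|b| ≤ 1/4`,
`r < 1/4`, lie in `Q = 𝒞 × ]-1, 0[` (`parabolicCylinder_axis_subset_parCyl`), where the solution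
is distributional. The Type I hypothesis and the axial symmetry of `PressureDecay` are not used.

## References

* G. Seregin, V. Šverák, Comm. PDE 34 (2009) = arXiv:0804.1803, §3 p. 9 (cylinders `𝒞`,
  `Q(z₀, R)`, functionals `C`, `D`), proof of Lemma 3.5, (as5), (as13) (p. 10).
  [`SereginSverak2009`]
* G. Seregin, *Lecture notes on regularity theory for the Navier–Stokes equations* (2014), §6.5
  ("just for convenience, we replace balls `B(r)` with cylinders `𝒞(r)`"). [`Seregin2014`]
-/

noncomputable section

open MeasureTheory Set Function Filter Topology TopologicalSpace Metric
open scoped NNReal ENNReal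

namespace Literature.Analysis.FluidPDE

/-! ### Balls and the coordinate cylinders `𝒞` -/

/-! Two coordinate bounds (`|y'| ≤ |y|`, `|y₃| ≤ |y|`) are used below; they are kept as local
`have`s because the tree already has them under `Literature.Barriers.NavierStokesRegularity`
(`AxisymmetricTypeIExclusionProofs.lean`), which is not imported here. -/

/-- `B(x₀, R) ⊆ 𝒞(x₀, R)`. [folklore] -/
theorem ball_subset_spaceCyl (x₀ : EuclideanSpace ℝ (Fin 3)) (R : ℝ) :
    ball x₀ R ⊆ SereginSverak2009.spaceCyl x₀ R := by
  intro x hx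
  rw [mem_ball, dist_eq_norm] at hx
  rw [SereginSverak2009.mem_spaceCyl]
  have hcyl : cylRadius (x - x₀) ≤ ‖x - x₀‖ := by
    rw [EuclideanSpace.norm_eq, cylRadius]
    apply Real.sqrt_le_sqrt
    simp only [Fin.sum_univ_three, Real.norm_eq_abs, sq_abs]
    nlinarith [sq_nonneg ((x - x₀) 2)]
  have h2 : |(x - x₀) 2| ≤ ‖x - x₀‖ := by
    simpa only [Real.norm_eq_abs] using PiLp.norm_apply_le (x - x₀) 2
  refine ⟨hcyl.trans_lt hx, ?_⟩
  exact lt_of_le_of_lt (by simpa using h2) hx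

/-- `𝒞(x₀, R) ⊆ B(x₀, √2 R)` (`|x - x₀|² = |x' - x₀'|² + |x₃ - x₀₃|² < 2R²`). [folklore] -/
theorem spaceCyl_subset_ball (x₀ : EuclideanSpace ℝ (Fin 3)) {R : ℝ} (hR : 0 ≤ R) :
    SereginSverak2009.spaceCyl x₀ R ⊆ ball x₀ (Real.sqrt 2 * R) := by
  intro x hx
  rw [SereginSverak2009.mem_spaceCyl] at hx
  obtain ⟨h1, h2⟩ := hx
  rw [mem_ball, dist_eq_norm]
  have hc := cylRadius_nonneg (x - x₀)
  have hnsq : ‖x - x₀‖ ^ 2 = (x - x₀) 0 ^ 2 + (x - x₀) 1 ^ 2 + (x - x₀) 2 ^ 2 := by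
    rw [EuclideanSpace.norm_eq, Real.sq_sqrt (by positivity), Fin.sum_univ_three]
    simp only [Real.norm_eq_abs, sq_abs]
  have hsq : ‖x - x₀‖ ^ 2 < (Real.sqrt 2 * R) ^ 2 := by
    rw [hnsq, mul_pow, Real.sq_sqrt (by norm_num : (0 : ℝ) ≤ 2)]
    have e1 : (x - x₀) 0 ^ 2 + (x - x₀) 1 ^ 2 = cylRadius (x - x₀) ^ 2 := (cylRadius_sq _).symm
    have h3 : cylRadius (x - x₀) ^ 2 < R ^ 2 := by nlinarith
    have h4 : (x - x₀) 2 ^ 2 < R ^ 2 := by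
      have : |(x - x₀) 2| ^ 2 < R ^ 2 := by
        have hab : |(x - x₀) 2| < R := by simpa using h2
        nlinarith [abs_nonneg ((x - x₀) 2)]
      rwa [sq_abs] at this
    linarith
  exact lt_of_pow_lt_pow_left₀ 2 (by positivity) hsq

/-- `Q_R(z₀) ⊆ Q(z₀, R)`: the Caffarelli–Kohn–Nirenberg cylinder (balls) inside Seregin–Šverák's
(coordinate cylinders), same time window. [folklore] -/
theorem parabolicCylinder_subset_parCyl (z₀ : ℝ × EuclideanSpace ℝ (Fin 3)) (R : ℝ) :
    parabolicCylinder R z₀ ⊆ SereginSverak2009.parCyl z₀ R := by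
  intro w hw
  obtain ⟨h1, h2⟩ := hw
  exact ⟨h1, ball_subset_spaceCyl z₀.2 R h2⟩

/-- `Q(z₀, R) ⊆ Q_{√2 R}(z₀)` for `R ≥ 0` (coordinate cylinder in the ball of radius `√2 R`, time
window `]t₀ - R², t₀[ ⊆ ]t₀ - 2R², t₀[`). [folklore] -/
theorem parCyl_subset_parabolicCylinder (z₀ : ℝ × EuclideanSpace ℝ (Fin 3)) {R : ℝ} (hR : 0 ≤ R) :
    SereginSverak2009.parCyl z₀ R ⊆ parabolicCylinder (Real.sqrt 2 * R) z₀ := by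
  intro w hw
  rw [SereginSverak2009.mem_parCyl] at hw
  obtain ⟨⟨h1, h2⟩, h3, h4⟩ := hw
  have hx : w.2 ∈ ball z₀.2 (Real.sqrt 2 * R) :=
    spaceCyl_subset_ball z₀.2 hR ((SereginSverak2009.mem_spaceCyl).2 ⟨h3, h4⟩)
  refine ⟨⟨?_, h2⟩, hx⟩
  have : (Real.sqrt 2 * R) ^ 2 = 2 * R ^ 2 := by
    rw [mul_pow, Real.sq_sqrt (by norm_num : (0 : ℝ) ≤ 2)]
  rw [this]
  nlinarith

/-- The ball cylinders about the axis points of (as5) lie in `Q = 𝒞 × ]-1, 0[`: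
`Q_r(0, b e₃) ⊆ Q(0, 1)` for `|b| ≤ 1/4`, `0 < r < 1/4`. [cite: SereginSverak2009, proof of Lemma 3.5, (as5)] -/
theorem parabolicCylinder_axis_subset_parCyl {b r : ℝ} (hb : |b| ≤ 1 / 4) (hr : r ∈ Ioo (0 : ℝ) (1 / 4)) :
    parabolicCylinder r ((0 : ℝ), b • eZ) ⊆ SereginSverak2009.parCyl 0 1 := by
  intro w hw
  rw [mem_parabolicCylinder] at hw
  obtain ⟨⟨h1, h2⟩, h3⟩ := hw
  dsimp only at h1 h2 h3
  rw [SereginSverak2009.mem_parCyl_zero]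
  rw [dist_eq_norm] at h3
  have hr2 : r ^ 2 < 1 := by nlinarith [hr.1, hr.2]
  have hball : w.2 ∈ SereginSverak2009.spaceCyl (b • eZ) r :=
    ball_subset_spaceCyl (b • eZ) r (mem_ball.2 (by rwa [dist_eq_norm]))
  rw [SereginSverak2009.mem_spaceCyl] at hball
  refine ⟨⟨by linarith, h2⟩, ?_, ?_⟩
  · calc cylRadius w.2 = cylRadius (w.2 - b • eZ) := (cylRadius_sub_smul_eZ _ _).symm
      _ < r := hball.1
      _ < 1 := by linarith [hr.2]
  · have h4 : |(w.2 - b • eZ) 2| < r := hball.2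
    have h5 : (w.2 - b • eZ) 2 = w.2 2 - b := by simp
    rw [h5] at h4
    have h6 : |w.2 2| ≤ |w.2 2 - b| + |b| := by
      calc |w.2 2| = |(w.2 2 - b) + b| := by ring_nf
        _ ≤ |w.2 2 - b| + |b| := abs_add_le _ _
    linarith [hr.2]

/-! ### Comparison of the functionals -/

/-- `D_B(r) ≤ D_𝒞(r)` (same normalisation, `Q_r ⊆ Q(·, r)`). [folklore] -/
theorem cknD_le_pressureD (z₀ : ℝ × EuclideanSpace ℝ (Fin 3)) (r : ℝ) (p : ℝ → EuclideanSpace ℝ (Fin 3) → ℝ) :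
    cknD r z₀ p ≤ SereginSverak2009.pressureD z₀ r p :=
  mul_le_mul_right (lintegral_mono_set (parabolicCylinder_subset_parCyl z₀ r)) _

/-- `C_B(r) ≤ C_𝒞(r)` (same normalisation, `Q_r ⊆ Q(·, r)`). [folklore] -/
theorem cknC_le_cubicC (z₀ : ℝ × EuclideanSpace ℝ (Fin 3)) (r : ℝ)
    (u : ℝ → EuclideanSpace ℝ (Fin 3) → EuclideanSpace ℝ (Fin 3)) :
    cknC r z₀ u ≤ SereginSverak2009.cubicC z₀ r u :=
  mul_le_mul_right (lintegral_mono_set (parabolicCylinder_subset_parCyl z₀ r)) _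

/-- `D_𝒞(ϱ) ≤ 2 D_B(√2 ϱ)` for `ϱ > 0` (`Q(·, ϱ) ⊆ Q_{√2ϱ}`, `(√2ϱ)²/ϱ² = 2`). [folklore] -/
theorem pressureD_le_two_mul_cknD (z₀ : ℝ × EuclideanSpace ℝ (Fin 3)) {ϱ : ℝ} (hϱ : 0 < ϱ)
    (p : ℝ → EuclideanSpace ℝ (Fin 3) → ℝ) :
    SereginSverak2009.pressureD z₀ ϱ p ≤ 2 * cknD (Real.sqrt 2 * ϱ) z₀ p := by
  have hs : 0 < Real.sqrt 2 * ϱ := by positivity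
  have e2 : ENNReal.ofReal (Real.sqrt 2 * ϱ) ^ 2 = 2 * ENNReal.ofReal ϱ ^ 2 := by
    rw [← ENNReal.ofReal_pow hs.le, ← ENNReal.ofReal_pow hϱ.le, mul_pow,
      Real.sq_sqrt (by norm_num : (0 : ℝ) ≤ 2), ENNReal.ofReal_mul (by norm_num), ENNReal.ofReal_ofNat]
  have e3 : 2 * (ENNReal.ofReal (Real.sqrt 2 * ϱ) ^ 2)⁻¹ = (ENNReal.ofReal ϱ ^ 2)⁻¹ := by
    rw [e2, ENNReal.mul_inv (Or.inl two_ne_zero) (Or.inl ENNReal.ofNat_ne_top), ← mul_assoc,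
      ENNReal.mul_inv_cancel two_ne_zero ENNReal.ofNat_ne_top, one_mul]
  rw [SereginSverak2009.pressureD, cknD]
  calc (ENNReal.ofReal ϱ ^ 2)⁻¹ * ∫⁻ w in SereginSverak2009.parCyl z₀ ϱ, ‖p w.1 w.2‖ₑ ^ (3 / 2 : ℝ)
      ≤ (ENNReal.ofReal ϱ ^ 2)⁻¹ *
          ∫⁻ w in parabolicCylinder (Real.sqrt 2 * ϱ) z₀, ‖p w.1 w.2‖ₑ ^ (3 / 2 : ℝ) :=
        mul_le_mul_right (lintegral_mono_set (parCyl_subset_parabolicCylinder z₀ hϱ.le)) _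
    _ = 2 * ((ENNReal.ofReal (Real.sqrt 2 * ϱ) ^ 2)⁻¹ *
            ∫⁻ w in parabolicCylinder (Real.sqrt 2 * ϱ) z₀, ‖p w.1 w.2‖ₑ ^ (3 / 2 : ℝ)) := by
        rw [← mul_assoc, e3]

/-- `D_𝒞(ϱ) ≤ (r/ϱ)² D_𝒞(r)` for `0 < ϱ ≤ r` (monotonicity of the integral in the cylinder). [folklore] -/
theorem pressureD_le_sq_mul_pressureD (z₀ : ℝ × EuclideanSpace ℝ (Fin 3)) {ϱ r : ℝ} (hϱ : 0 < ϱ)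
    (hϱr : ϱ ≤ r) (p : ℝ → EuclideanSpace ℝ (Fin 3) → ℝ) :
    SereginSverak2009.pressureD z₀ ϱ p ≤
      ENNReal.ofReal ((r / ϱ) ^ 2) * SereginSverak2009.pressureD z₀ r p := by
  have hr : 0 < r := hϱ.trans_le hϱr
  have hr0 : ENNReal.ofReal r ^ 2 ≠ 0 := pow_ne_zero _ (ENNReal.ofReal_pos.2 hr).ne'
  have hrt : ENNReal.ofReal r ^ 2 ≠ ∞ := ENNReal.pow_ne_top ENNReal.ofReal_ne_top
  have e : (ENNReal.ofReal ϱ ^ 2)⁻¹ * ENNReal.ofReal r ^ 2 = ENNReal.ofReal ((r / ϱ) ^ 2) := by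
    rw [← ENNReal.ofReal_pow hϱ.le, ← ENNReal.ofReal_pow hr.le, ← ENNReal.ofReal_inv_of_pos (by positivity),
      ← ENNReal.ofReal_mul (by positivity)]
    congr 1
    field_simp
  rw [SereginSverak2009.pressureD, SereginSverak2009.pressureD]
  calc (ENNReal.ofReal ϱ ^ 2)⁻¹ * ∫⁻ w in SereginSverak2009.parCyl z₀ ϱ, ‖p w.1 w.2‖ₑ ^ (3 / 2 : ℝ)
      ≤ (ENNReal.ofReal ϱ ^ 2)⁻¹ * ∫⁻ w in SereginSverak2009.parCyl z₀ r, ‖p w.1 w.2‖ₑ ^ (3 / 2 : ℝ) :=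
        mul_le_mul_right (lintegral_mono_set (SereginSverak2009.parCyl_mono z₀ hϱ.le hϱr)) _
    _ = ((ENNReal.ofReal ϱ ^ 2)⁻¹ * ENNReal.ofReal r ^ 2) *
          ((ENNReal.ofReal r ^ 2)⁻¹ * ∫⁻ w in SereginSverak2009.parCyl z₀ r, ‖p w.1 w.2‖ₑ ^ (3 / 2 : ℝ)) := by
        rw [mul_assoc, ← mul_assoc (ENNReal.ofReal r ^ 2), ENNReal.mul_inv_cancel hr0 hrt, one_mul]
    _ = _ := by rw [e]

/-! ### (as13) on the cylinders `𝒞` from the ball form -/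

/-- Elementary real arithmetic of the comparison: `2 (√2 ϱ/r) ≤ 3 (ϱ/r)` for `r > 0`, `ϱ ≥ 0`. [folklore] -/
theorem two_mul_sqrt_two_ratio_le {ϱ r : ℝ} (hϱ : 0 ≤ ϱ) (hr : 0 < r) :
    2 * (Real.sqrt 2 * ϱ / r) ≤ 3 * (ϱ / r) := by
  have hs : Real.sqrt 2 ≤ 3 / 2 := by
    rw [Real.sqrt_le_left (by norm_num)]
    norm_num
  have h1 : 0 ≤ ϱ / r := div_nonneg hϱ hr.le
  calc 2 * (Real.sqrt 2 * ϱ / r) = (2 * Real.sqrt 2) * (ϱ / r) := by ring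
    _ ≤ 3 * (ϱ / r) := mul_le_mul_of_nonneg_right (by linarith) h1

/-- **Seregin–Šverák 2009, (as13) (`SereginSverak2009.PressureDecay`, coordinate cylinders `𝒞`)
from the ball form `seregin_sverak_pressure_decay`.** With `c` the constant of the ball form,
`c' = 3c + 3` works for the cylinders `𝒞`: for `√2 ϱ ≤ r`,
`D_𝒞(ϱ) ≤ 2 D_B(√2ϱ) ≤ 2c [√2 (ϱ/r) D_B(r) + (r/(√2ϱ))² C_B(r)] ≤ 3c (ϱ/r) D_𝒞(r) + c (r/ϱ)² C_𝒞(r)`;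
for `r < √2 ϱ`, `D_𝒞(ϱ) ≤ (r/ϱ)² D_𝒞(r) ≤ 2 D_𝒞(r) ≤ 3 (ϱ/r) D_𝒞(r)`. The ball form applies
because `(u, p)` is distributional on `Q = 𝒞 × ]-1, 0[ ⊇ Q_r(0, b e₃)`.
[cite: SereginSverak2009, proof of Lemma 3.5, (as13) (arXiv:0804.1803 p. 10)] -/
theorem SereginSverak2009.pressureDecay_of_seregin_sverak_pressure_decay
    (h : seregin_sverak_pressure_decay) : SereginSverak2009.PressureDecay := by
  obtain ⟨c, hc⟩ := h
  refine ⟨3 * c + 3, fun u p hsol _ b hb r hr ϱ hϱ => ?_⟩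
  have hr0 : 0 < r := hr.1
  have hϱ0 : 0 < ϱ := hϱ.1
  have hϱr : ϱ ≤ r := hϱ.2
  set z : ℝ × EuclideanSpace ℝ (Fin 3) := ((0 : ℝ), b • eZ) with hz
  set D := SereginSverak2009.pressureD z r p with hD
  set C := SereginSverak2009.cubicC z r u with hC
  have hsubQ : parabolicCylinder r z ⊆ ((SereginSverak2009.parCylOpens 0 1 : Opens (ℝ × EuclideanSpace ℝ (Fin 3))) :
      Set (ℝ × EuclideanSpace ℝ (Fin 3))) := by
    rw [SereginSverak2009.coe_parCylOpens]
    exact parabolicCylinder_axis_subset_parCyl hb hr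
  -- the common final bound
  have hfinal : ∀ X : ℝ≥0∞,
      X ≤ 3 * ((c : ℝ≥0∞) * (ENNReal.ofReal (ϱ / r) * D)) + (c : ℝ≥0∞) * (ENNReal.ofReal ((r / ϱ) ^ 2) * C) +
        3 * (ENNReal.ofReal (ϱ / r) * D) →
      X ≤ ((3 * c + 3 : ℝ≥0) : ℝ≥0∞) * (ENNReal.ofReal (ϱ / r) * D + ENNReal.ofReal ((r / ϱ) ^ 2) * C) := by
    intro X hX
    refine hX.trans ?_
    push_cast
    have : (c : ℝ≥0∞) * (ENNReal.ofReal ((r / ϱ) ^ 2) * C) ≤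
        (3 * (c : ℝ≥0∞) + 3) * (ENNReal.ofReal ((r / ϱ) ^ 2) * C) := by
      refine mul_le_mul_left ?_ _
      calc (c : ℝ≥0∞) = 1 * c + 0 := by ring
        _ ≤ 3 * c + 3 := add_le_add (mul_le_mul_left (by norm_num) _) bot_le
    calc 3 * ((c : ℝ≥0∞) * (ENNReal.ofReal (ϱ / r) * D)) + (c : ℝ≥0∞) * (ENNReal.ofReal ((r / ϱ) ^ 2) * C) +
          3 * (ENNReal.ofReal (ϱ / r) * D)
        = (3 * (c : ℝ≥0∞) + 3) * (ENNReal.ofReal (ϱ / r) * D) +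
            (c : ℝ≥0∞) * (ENNReal.ofReal ((r / ϱ) ^ 2) * C) := by ring
      _ ≤ (3 * (c : ℝ≥0∞) + 3) * (ENNReal.ofReal (ϱ / r) * D) +
            (3 * (c : ℝ≥0∞) + 3) * (ENNReal.ofReal ((r / ϱ) ^ 2) * C) := add_le_add le_rfl this
      _ = (3 * (c : ℝ≥0∞) + 3) * (ENNReal.ofReal (ϱ / r) * D + ENNReal.ofReal ((r / ϱ) ^ 2) * C) := by ring
  by_cases hcase : Real.sqrt 2 * ϱ ≤ r
  · -- the ball estimate between the radii `√2 ϱ ≤ r`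
    have hs : 0 < Real.sqrt 2 * ϱ := by positivity
    have key := hc (SereginSverak2009.parCylOpens 0 1) u p hsol.distributional z r (Real.sqrt 2 * ϱ) hs hcase hsubQ
    have e1 : 2 * ENNReal.ofReal (Real.sqrt 2 * ϱ / r) ≤ 3 * ENNReal.ofReal (ϱ / r) := by
      rw [← ENNReal.ofReal_ofNat 2, ← ENNReal.ofReal_ofNat 3, ← ENNReal.ofReal_mul (by norm_num),
        ← ENNReal.ofReal_mul (by norm_num)]
      exact ENNReal.ofReal_le_ofReal (two_mul_sqrt_two_ratio_le hϱ0.le hr0)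
    have e2 : 2 * ENNReal.ofReal ((r / (Real.sqrt 2 * ϱ)) ^ 2) = ENNReal.ofReal ((r / ϱ) ^ 2) := by
      rw [← ENNReal.ofReal_ofNat 2, ← ENNReal.ofReal_mul (by norm_num)]
      congr 1
      rw [div_pow, mul_pow, Real.sq_sqrt (by norm_num : (0 : ℝ) ≤ 2)]
      field_simp
    refine hfinal _ ?_
    calc SereginSverak2009.pressureD z ϱ p
        ≤ 2 * cknD (Real.sqrt 2 * ϱ) z p := pressureD_le_two_mul_cknD z hϱ0 p
      _ ≤ 2 * ((c : ℝ≥0∞) * (ENNReal.ofReal (Real.sqrt 2 * ϱ / r) * cknD r z p +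
            ENNReal.ofReal ((r / (Real.sqrt 2 * ϱ)) ^ 2) * cknC r z u)) := mul_le_mul_right key 2
      _ ≤ 2 * ((c : ℝ≥0∞) * (ENNReal.ofReal (Real.sqrt 2 * ϱ / r) * D +
            ENNReal.ofReal ((r / (Real.sqrt 2 * ϱ)) ^ 2) * C)) := by
          gcongr
          · exact cknD_le_pressureD z r p
          · exact cknC_le_cubicC z r u
      _ = (c : ℝ≥0∞) * ((2 * ENNReal.ofReal (Real.sqrt 2 * ϱ / r)) * D) +
            (c : ℝ≥0∞) * ((2 * ENNReal.ofReal ((r / (Real.sqrt 2 * ϱ)) ^ 2)) * C) := by ring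
      _ ≤ (c : ℝ≥0∞) * ((3 * ENNReal.ofReal (ϱ / r)) * D) +
            (c : ℝ≥0∞) * (ENNReal.ofReal ((r / ϱ) ^ 2) * C) := by
          rw [e2]
          exact add_le_add (mul_le_mul_right (mul_le_mul_left e1 D) _) le_rfl
      _ = 3 * ((c : ℝ≥0∞) * (ENNReal.ofReal (ϱ / r) * D)) + (c : ℝ≥0∞) * (ENNReal.ofReal ((r / ϱ) ^ 2) * C) := by
          ring
      _ ≤ _ := le_self_add
  · -- `r < √2 ϱ`: trivially `D_𝒞(ϱ) ≤ (r/ϱ)² D_𝒞(r) ≤ 3 (ϱ/r) D_𝒞(r)`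
    rw [not_le] at hcase
    have e3 : ENNReal.ofReal ((r / ϱ) ^ 2) ≤ 3 * ENNReal.ofReal (ϱ / r) := by
      rw [← ENNReal.ofReal_ofNat 3, ← ENNReal.ofReal_mul (by norm_num)]
      refine ENNReal.ofReal_le_ofReal ?_
      -- `(r/ϱ)² < 2` and `ϱ/r > 1/√2`, so `(r/ϱ)² ≤ 2 ≤ 3/√2 < 3 ϱ/r`
      have h1 : r / ϱ < Real.sqrt 2 := by rw [div_lt_iff₀ hϱ0]; linarith
      have h2 : (r / ϱ) ^ 2 < 2 := by
        have h0 : 0 ≤ r / ϱ := div_nonneg hr0.le hϱ0.le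
        nlinarith [Real.sq_sqrt (show (0 : ℝ) ≤ 2 by norm_num), Real.sqrt_nonneg 2]
      have hs : Real.sqrt 2 ≤ 3 / 2 := by
        rw [Real.sqrt_le_left (by norm_num)]
        norm_num
      have h3 : 2 ≤ 3 * (ϱ / r) := by
        rw [← mul_div_assoc, le_div_iff₀ hr0]
        nlinarith
      linarith
    refine hfinal _ ?_
    calc SereginSverak2009.pressureD z ϱ p
        ≤ ENNReal.ofReal ((r / ϱ) ^ 2) * D := pressureD_le_sq_mul_pressureD z hϱ0 hϱr p
      _ ≤ (3 * ENNReal.ofReal (ϱ / r)) * D := mul_le_mul_left e3 D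
      _ = 3 * (ENNReal.ofReal (ϱ / r) * D) := by ring
      _ ≤ _ := le_add_self

end Literature.Analysis.FluidPDE

end
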